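import Mathlib.NumberTheory.RamificationInertia.Valuation
import Mathlib.NumberTheory.NumberField.Completion.FinitePlace

/-!
# Finite places: the completion `Kᵥ → L_w` for `w ∣ v` — ring map, continuity, algebra structure, finiteness
(cell pub-hodge-repro2, seat p3)

Tier-5 N2 support, §N2.9.2 of route/T5-N2-route-3.md («completions»), at the FINITE places. The census of this
column (route/T5-SUPPORT-p3.md §56; HANDOFF-p3.md g57 block) recorded the identification
`E ⊗_F F_v = ∏_{w ∣ v} E_w` as prose-class because «extension-of-valuations theory is absent from Mathlib 81a5d257».
It is not absent: `Mathlib/NumberTheory/RamificationInertia/Valuation.lean` (S. Mercuri, 2026) proves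
`valuation_liesOver : v.valuation K x ^ e(w|v) = w.valuation L (algebraMap K L x)` and
`uniformContinuous_algebraMap_liesOver` (the algebra map `K → L` is uniformly continuous for the `v`- and `w`-adic
uniformities). This file draws the consequences that Mathlib's own instance `Module.Finite Kv Lw`
(Completion/FinitePlace.lean ll. 484–507) takes as HYPOTHESES:

* `completionMap : v.adicCompletion K →+* w.adicCompletion L`, the completion of `algebraMap K L`
  (`completionMap_coe`), continuous (`continuous_completionMap`), injective;
* the scoped instances `Algebra Kᵥ L_w`, `IsScalarTower K Kᵥ L_w`, `ContinuousSMul Kᵥ L_w` — scoped exactly as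
  Mathlib scopes the archimedean analogues in Completion/LiesOverInstances.lean (a global instance would create a
  non-defeq diamond when `K = L`);
* for number fields: `finite : Module.Finite Kᵥ L_w` (so `[E_w : F_v] < ∞`, `finrank_pos`) and
  `tensorLift_surjective : Kᵥ ⊗[K] L → L_w` is onto (`L_w = Kᵥ · L`, one factor of the splitting; the dimension
  count `Σ_{w ∣ v} [L_w : Kᵥ] = [L : K]` — the other half of the identification — is NOT here).

No display; no device. §8(d): uses an L-value-free non-vanishing device: NO.
-/

namespace Summit.Ventures.HodgeRepro2.T5FinitePlaceLiesOver

open IsDedekindDomain IsDedekindDomain.HeightOneSpectrum UniformSpace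

section AKLB

variable {A K : Type*} (L : Type*) {B : Type*}
variable [CommRing A] [IsDedekindDomain A] [CommRing B] [IsDedekindDomain B] [Algebra A B]
  [Module.IsTorsionFree A B]
variable [Field K] [Field L] [Algebra K L]
variable [Algebra A K] [IsFractionRing A K] [Algebra A L] [IsScalarTower A K L]
variable [Algebra B L] [IsFractionRing B L] [IsScalarTower A B L]
variable (v : HeightOneSpectrum A) (w : HeightOneSpectrum B) [w.asIdeal.LiesOver v.asIdeal]

variable (K)

/-- The completion of `algebraMap K L` on the underlying uniform-space completions,
`(v.valuation K).Completion →+* (w.valuation L).Completion`. -/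
noncomputable def completionMapAux : (v.valuation K).Completion →+* (w.valuation L).Completion :=
  Completion.mapRingHom (algebraMap (WithVal (v.valuation K)) (WithVal (w.valuation L)))
    (uniformContinuous_algebraMap_liesOver K L v w).continuous

/-- `completionMapAux` on the dense image of `K`. -/
theorem completionMapAux_coe (x : WithVal (v.valuation K)) :
    completionMapAux K L v w (x : (v.valuation K).Completion) =
      ((algebraMap (WithVal (v.valuation K)) (WithVal (w.valuation L)) x :
        WithVal (w.valuation L)) : (w.valuation L).Completion) :=
  Completion.mapRingHom_coe _ _

/-- The ring homomorphism `Kᵥ →+* L_w` induced by `algebraMap K L` when `w` lies over `v`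
(the finite-place analogue of `NumberField.LiesOver.completionMap`). -/
noncomputable def completionMap : v.adicCompletion K →+* w.adicCompletion L :=
  ((adicCompletion.equiv L w).symm.toRingHom.comp (completionMapAux K L v w)).comp
    (adicCompletion.equiv K v).toRingHom

/-- `completionMap` unwrapped. -/
theorem completionMap_toCompletion (x : v.adicCompletion K) :
    (completionMap K L v w x).toCompletion = completionMapAux K L v w x.toCompletion := rfl

/-- `completionMap` restricted to `K` is `algebraMap K L`. -/
theorem completionMap_coe (x : K) :
    completionMap K L v w (x : v.adicCompletion K) = ((algebraMap K L x : L) : w.adicCompletion L) := by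
  apply adicCompletion.ext
  rw [completionMap_toCompletion, adicCompletion.coe_toCompletion, adicCompletion.coe_toCompletion]
  exact completionMapAux_coe K L v w _

/-- `completionMap` is continuous. -/
theorem continuous_completionMap : Continuous (completionMap K L v w) :=
  (adicCompletion.continuous_ofCompletion L w).comp <|
    Completion.continuous_map.comp (adicCompletion.continuous_toCompletion K v)

/-- `completionMap` is injective (a ring homomorphism between fields). -/
theorem completionMap_injective : Function.Injective (completionMap K L v w) :=
  (completionMap K L v w).injective

/-- `L_w` is a `Kᵥ`-algebra when `w ∣ v`. Scoped, as Mathlib scopes the archimedean analogue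
(`NumberField.LiesOver.instAlgebraCompletion`): when `K = L` it is not definitionally `Algebra.id`. -/
noncomputable scoped instance instAlgebra : Algebra (v.adicCompletion K) (w.adicCompletion L) :=
  (completionMap K L v w).toAlgebra

/-- The structure map of the scoped algebra is `completionMap`. -/
theorem algebraMap_eq_completionMap :
    algebraMap (v.adicCompletion K) (w.adicCompletion L) = completionMap K L v w := rfl

/-- `K → Kᵥ → L_w` is `K → L → L_w`. -/
scoped instance instIsScalarTower : IsScalarTower K (v.adicCompletion K) (w.adicCompletion L) :=
  .of_algebraMap_eq fun x ↦ by
    rw [algebraMap_eq_completionMap]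
    exact (completionMap_coe K L v w x).symm

/-- The `Kᵥ`-action on `L_w` is continuous. -/
scoped instance instContinuousSMul : ContinuousSMul (v.adicCompletion K) (w.adicCompletion L) where
  continuous_smul := ((continuous_completionMap K L v w).comp continuous_fst).mul continuous_snd

open scoped WithZeroTopology in
/-- **Extension of valuations on the completions:** `w(completionMap x) = v(x)^{e(w|v)}` for every `x ∈ Kᵥ` —
Mathlib's `valuation_liesOver` (on `K`) extended to `Kᵥ` by density of `K` and continuity of both sides. -/
theorem valued_completionMap (x : v.adicCompletion K) :
    Valued.v (completionMap K L v w x) = Valued.v x ^ v.asIdeal.ramificationIdx' w.asIdeal := by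
  have hd : DenseRange (algebraMap K (v.adicCompletion K)) := denseRange_algebraMap (K := K) (v := v)
  have h1 : Continuous fun y : v.adicCompletion K => Valued.v (completionMap K L v w y) :=
    (Valued.continuous_valuation_of_surjective
      (valuedAdicCompletion_surjective (K := L) (v := w))).comp (continuous_completionMap K L v w)
  have h2 : Continuous fun y : v.adicCompletion K =>
      Valued.v y ^ v.asIdeal.ramificationIdx' w.asIdeal :=
    (Valued.continuous_valuation_of_surjective (valuedAdicCompletion_surjective (K := K) (v := v))).pow _
  refine congrFun (hd.equalizer h1 h2 (funext fun k => ?_)) x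
  simp only [Function.comp_apply]
  rw [show algebraMap K (v.adicCompletion K) k = (k : v.adicCompletion K) from rfl, completionMap_coe,
    adicCompletion.valued_coe, adicCompletion.valued_coe]
  exact (valuation_liesOver L v w k).symm

/-- `completionMap` maps `v`-adic integers to `w`-adic integers. -/
theorem completionMap_mem_adicCompletionIntegers {x : v.adicCompletion K}
    (hx : x ∈ v.adicCompletionIntegers K) : completionMap K L v w x ∈ w.adicCompletionIntegers L := by
  rw [mem_adicCompletionIntegers] at hx ⊢
  rw [valued_completionMap]
  exact pow_le_one' hx _

/-- `completionMap` is a unit at a `v`-adic unit. -/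
theorem valued_completionMap_eq_one {x : v.adicCompletion K} (hx : Valued.v x = 1) :
    Valued.v (completionMap K L v w x) = 1 := by
  rw [valued_completionMap, hx, one_pow]

/-- `completionMap` as a `K`-algebra homomorphism `Kᵥ →ₐ[K] L_w`. -/
noncomputable def completionMapₐ : v.adicCompletion K →ₐ[K] w.adicCompletion L where
  toRingHom := completionMap K L v w
  commutes' k := (completionMap_coe K L v w k).trans rfl

/-- `completionMapₐ` is `completionMap`. -/
theorem completionMapₐ_apply (x : v.adicCompletion K) : completionMapₐ K L v w x = completionMap K L v w x := rfl

end AKLB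

section NumberField

open NumberField
open scoped Valued TensorProduct

variable {K L : Type*} [Field K] [NumberField K] [Field L] [NumberField L] [Algebra K L]
variable (v : HeightOneSpectrum (𝓞 K)) (w : HeightOneSpectrum (𝓞 L)) [w.asIdeal.LiesOver v.asIdeal]

/-- **`[L_w : Kᵥ] < ∞`** for number fields `K ⊆ L` and `w ∣ v`: Mathlib's instance
`NumberField.HeightOneSpectrum.instModuleFinite…` (Completion/FinitePlace.lean) applied to the scoped
algebra structure of this file. -/
theorem finite : Module.Finite (v.adicCompletion K) (w.adicCompletion L) := inferInstance

/-- `L_w` is finite-dimensional over `Kᵥ`. -/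
theorem finiteDimensional : FiniteDimensional (v.adicCompletion K) (w.adicCompletion L) := finite v w

/-- `0 < [L_w : Kᵥ]`. -/
theorem finrank_pos : 0 < Module.finrank (v.adicCompletion K) (w.adicCompletion L) :=
  haveI := finite v w
  Module.finrank_pos

/-- The `Kᵥ`-algebra map `Kᵥ ⊗[K] L →ₐ[Kᵥ] L_w`, `a ⊗ l ↦ a · l`. -/
noncomputable def tensorLift : (v.adicCompletion K) ⊗[K] L →ₐ[v.adicCompletion K] w.adicCompletion L :=
  Algebra.TensorProduct.lift (Algebra.algHom (v.adicCompletion K) (v.adicCompletion K) (w.adicCompletion L))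
    (Algebra.algHom K L (w.adicCompletion L)) (fun _ _ ↦ mul_comm _ _)

/-- `tensorLift (a ⊗ l) = a · l`. -/
theorem tensorLift_tmul (a : v.adicCompletion K) (l : L) :
    tensorLift v w (a ⊗ₜ l) = algebraMap _ _ a * algebraMap L (w.adicCompletion L) l := by
  simp [tensorLift, Algebra.algHom]

/-- **`L_w = Kᵥ · L`:** the map `Kᵥ ⊗[K] L → L_w` is surjective (dense range by the density of `L` in
`L_w`, closed range because a finite-dimensional subspace over the complete field `Kᵥ` is closed — Mathlib's
argument for `Module.Finite Kᵥ L_w`, exported). -/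
theorem tensorLift_surjective : Function.Surjective (tensorLift v w) := by
  let Φ := (tensorLift v w).toLinearMap
  have h_dense : DenseRange Φ := by
    apply (w.denseRange_algebraMap L).mono
    rintro _ ⟨l, rfl⟩
    exact ⟨1 ⊗ₜ l, by simp [Φ, tensorLift, Algebra.algHom]⟩
  have h_closed : IsClosed (Set.range Φ) := by
    rw [← Φ.coe_range]
    exact Submodule.closed_of_finiteDimensional (𝕜 := v.adicCompletion K) Φ.range
  have h_univ : Set.range Φ = Set.univ := by
    rw [← h_closed.closure_eq]
    exact h_dense.closure_range
  exact Set.range_eq_univ.mp h_univ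

/-- **`[L_w : Kᵥ] ≤ [L : K]`:** the surjection `Kᵥ ⊗[K] L → L_w` and `finrank_baseChange`. (With
`finrank_pos` this is the whole dimension bookkeeping available at ONE place `w`; the count over all `w ∣ v` is not
in this file.) -/
theorem finrank_le : Module.finrank (v.adicCompletion K) (w.adicCompletion L) ≤ Module.finrank K L := by
  have h := LinearMap.finrank_le_finrank_of_surjective (f := (tensorLift v w).toLinearMap)
    (tensorLift_surjective v w)
  rwa [Module.finrank_baseChange] at h

end NumberField

end Summit.Ventures.HodgeRepro2.T5FinitePlaceLiesOver
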